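import Summits.CriticalPhenomena.PercolationContinuityZ3.Theorems.SahiMasterFamilyExplicitMinorDominationSingle

/-!
# Explicit minor domination at a SATURATING coordinate: `Λ_e(U) ≥ (1 − μ(U₂⁰))·Cov(U₀¹, U₁¹) ≥ 0` when `{e} ∈ U₂`

Unit `prim-master-conj` (crux anchor stmt-CriticalPhenomena-4575, helper work), gen 35; memo
`run/shared/lean/prim/prim-l12/prim-master-conj/POINTWISE.md` §36.4.  Notation as in gen 19's `…ExplicitMinorDominationSingle`: along a
coordinate `e`, `P = U⁰ = (secAt e false U_j)_j ⊆ Q = U¹ = (secAt e true U_j)_j`, and `MD_3` at `(U, e)` for every `p_e` is the single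
endpoint inequality `Λ_e(U) := mixC2_e(U) − E_3(U¹) ≥ 0` (`sahiE_three_ge_sq_minors_of_mixC2_ge`).

THIS FILE settles the endpoint inequality, with an explicit slack, on the class of coordinates that SATURATE one member
(`U₂¹ = univ`, i.e. `{e} ∈ U₂`, i.e. `U₂ ⊇ {ω | e ∈ ω}`; masterthm-p2's "canalyzing" coordinates of the second kind):
* `mixC2_sub_sahiE_eq_of_third_univ` — with `Q₂ = univ`, for ANY weight of total mass one and any `P, Q`:
  `Λ = (1 − μP₂)·(μ(Q₀Q₁) − μQ₀·μQ₁) + [μ(Q₀Q₁) − μ(P₀P₁)] − [μQ₁·μ(P₀P₂) − μ(P₀P₁P₂)] − [μQ₀·μ(P₁P₂) − μ(P₀P₁P₂)]`;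
* `mixC2_sub_sahiE_ge_cov_of_third_univ` — for increasing `U` under a product weight: **`Λ_e(U) ≥ (1 − μ(U₂⁰))·Cov(U₀¹, U₁¹)`**, because Harris
  bounds the two brackets by `μ((Q₁∖P₁) ∩ P₀ ∩ P₂)` and `μ((Q₀∖P₀) ∩ P₁ ∩ P₂)`, two DISJOINT parts of `Q₀Q₁ ∖ P₀P₁` (a pointwise indicator
  inequality, `ind_cover_of_subset`);
* `mixC2_ge_sahiE_of_third_univ` (`Λ ≥ 0`) and **`sahiE_three_ge_sq_minors_of_third_univ`**: `(1−p_e)²·E_3(U⁰) + p_e²·E_3(U¹) ≤ E_3(U)` —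
  `MD_3` at every coordinate saturating `U₂` (by the symmetry of `E_3` the slot is immaterial; stated for slot `2`).
So `C_3` and interior positivity transfer from the two minors at such coordinates with the sharp exponent `2` (gen 15's OR-shape theorem (B) needed
TWO saturated members).  Exact check: 600 random nested configurations, minimum slack `0` (seat folder `lab/test_oneomega.py`).
HONEST FRAMING: a small settled class; `Λ ≥ 0` in general, `C_3` and `MasterFamilyEqIff 3` remain OPEN. [this work]
-/

noncomputable section

open scoped Classical

namespace Summit.CriticalPhenomena.PercolationContinuityZ3.Theorems

open Finset Function
open Literature.Combinatorics.Sahi2008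
open Literature.Probability.Percolation.DecisionTree (ind ind_of_mem ind_of_not_mem ind_nonneg)
open SahiCombMix

namespace Pointwise

variable {ι : Type} [Fintype ι]

/-! ### 1. The identity at a saturating coordinate (any weight of mass one, any two triples with `Q 2 = univ`) -/

/-- `E(1_univ) = 1` under a weight of total mass one. [folklore] -/
theorem ex_ind_univ_of_sum_eq_one {μ : Set ι → ℝ} (hμ : ∑ ω, μ ω = 1) : ex μ (ind (Set.univ : Set (Set ι))) = 1 := by
  have h : ind (Set.univ : Set (Set ι)) = (1 : Set ι → ℝ) := by
    funext ω; exact ind_of_mem (Set.mem_univ ω)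
  rw [h]; exact ex_one hμ

/-- **`Λ` at a saturating coordinate, explicitly**: if `Q 2 = univ` then, for every weight of total mass one and all `P, Q`,
`mixC2 − E_3(1_Q) = (1 − μP₂)(μ(Q₀Q₁) − μQ₀μQ₁) + [μ(Q₀Q₁) − μ(P₀P₁)] − [μQ₁μ(P₀P₂) − μ(P₀P₁P₂)] − [μQ₀μ(P₁P₂) − μ(P₀P₁P₂)]`. [this work] -/
theorem mixC2_sub_sahiE_eq_of_third_univ {μ : Set ι → ℝ} (hμ : ∑ ω, μ ω = 1) (P Q : Fin 3 → Set (Set ι))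
    (h2 : Q 2 = Set.univ) :
    mixC2 μ P Q - sahiE μ 3 (fun j => ind (Q j))
      = (1 - ex μ (ind (P 2))) * (ex μ (ind (Q 0 ∩ Q 1)) - ex μ (ind (Q 0)) * ex μ (ind (Q 1)))
        + (ex μ (ind (Q 0 ∩ Q 1)) - ex μ (ind (P 0 ∩ P 1)))
        - (ex μ (ind (Q 1)) * ex μ (ind (P 0 ∩ P 2)) - ex μ (ind (P 0 ∩ P 1 ∩ P 2)))
        - (ex μ (ind (Q 0)) * ex μ (ind (P 1 ∩ P 2)) - ex μ (ind (P 0 ∩ P 1 ∩ P 2))) := by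
  rw [mixC2, sahiE_three_apply]
  simp only [ind_mul_ind_eq_inter, h2, Set.inter_univ, ex_ind_univ_of_sum_eq_one hμ]
  ring

/-! ### 2. The covering inequality and the bound for increasing events -/

omit [Fintype ι] in
/-- Pointwise: for `P_j ⊆ Q_j` (`j = 0, 1`),
`1_{Q₀∩(P₁∩P₂)} + 1_{Q₁∩(P₀∩P₂)} + 1_{P₀∩P₁} ≤ 1_{Q₀∩Q₁} + 2·1_{P₀∩P₁∩P₂}`. [this work] -/
theorem ind_cover_of_subset {P0 P1 P2 Q0 Q1 : Set (Set ι)} (h0 : P0 ⊆ Q0) (h1 : P1 ⊆ Q1) (ω : Set ι) :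
    ind (Q0 ∩ (P1 ∩ P2)) ω + ind (Q1 ∩ (P0 ∩ P2)) ω + ind (P0 ∩ P1) ω
      ≤ ind (Q0 ∩ Q1) ω + 2 * ind (P0 ∩ P1 ∩ P2) ω := by
  by_cases a0 : ω ∈ P0 <;> by_cases a1 : ω ∈ P1 <;> by_cases a2 : ω ∈ P2 <;> by_cases b0 : ω ∈ Q0 <;> by_cases b1 : ω ∈ Q1 <;>
    first
    | exact absurd (h0 a0) b0
    | exact absurd (h1 a1) b1
    | (simp only [ind, Set.mem_inter_iff, a0, a1, a2, b0, b1, and_true, and_false, if_true, if_false]; norm_num)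

/-- The integrated covering inequality: `μ(Q₀∩(P₁∩P₂)) + μ(Q₁∩(P₀∩P₂)) + μ(P₀∩P₁) ≤ μ(Q₀∩Q₁) + 2μ(P₀∩P₁∩P₂)` for `P_j ⊆ Q_j`
and any nonnegative weight. [this work] -/
theorem ex_cover_of_subset {μ : Set ι → ℝ} (hμ : ∀ ω, 0 ≤ μ ω) {P0 P1 P2 Q0 Q1 : Set (Set ι)} (h0 : P0 ⊆ Q0) (h1 : P1 ⊆ Q1) :
    ex μ (ind (Q0 ∩ (P1 ∩ P2))) + ex μ (ind (Q1 ∩ (P0 ∩ P2))) + ex μ (ind (P0 ∩ P1))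
      ≤ ex μ (ind (Q0 ∩ Q1)) + 2 * ex μ (ind (P0 ∩ P1 ∩ P2)) := by
  simp only [ex, ← sum_add_distrib, mul_sum]
  refine sum_le_sum fun ω _ => ?_
  have h := ind_cover_of_subset (P2 := P2) h0 h1 ω
  have hw := hμ ω
  nlinarith [mul_le_mul_of_nonneg_left h hw]

/-- **`Λ_e(U) ≥ (1 − μ(U₂⁰))·Cov(U₀¹, U₁¹)` at a coordinate saturating `U₂`** (increasing `U`, product weight, `secAt e true (U 2) = univ`).
[this work] -/
theorem mixC2_sub_sahiE_ge_cov_of_third_univ (p : ι → unitInterval) (e : ι) (U : Fin 3 → Set (Set ι)) (hU : ∀ j, IsUpperSet (U j))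
    (h2 : secAt e true (U 2) = Set.univ) :
    (1 - ex (bernoulliWeight p) (ind (secAt e false (U 2))))
        * (ex (bernoulliWeight p) (ind (secAt e true (U 0) ∩ secAt e true (U 1)))
            - ex (bernoulliWeight p) (ind (secAt e true (U 0))) * ex (bernoulliWeight p) (ind (secAt e true (U 1))))
      ≤ mixC2 (bernoulliWeight p) (fun j => secAt e false (U j)) (fun j => secAt e true (U j))
          - sahiE (bernoulliWeight p) 3 (fun j => ind (secAt e true (U j))) := by
  rw [mixC2_sub_sahiE_eq_of_third_univ (sum_bernoulliWeight p) _ _ h2]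
  have hμ := isFKGMeasure_bernoulliWeight p
  -- Harris: μQ₁·μ(P₀P₂) ≤ μ(Q₁∩(P₀∩P₂)) and μQ₀·μ(P₁P₂) ≤ μ(Q₀∩(P₁∩P₂))
  have hH1 := harris_ex_ind p (isUpperSet_secAt e true (hU 1))
    ((isUpperSet_secAt e false (hU 0)).inter (isUpperSet_secAt e false (hU 2)))
  have hH0 := harris_ex_ind p (isUpperSet_secAt e true (hU 0))
    ((isUpperSet_secAt e false (hU 1)).inter (isUpperSet_secAt e false (hU 2)))
  -- the covering inequality
  have hc := ex_cover_of_subset hμ.nonneg (P2 := secAt e false (U 2))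
    (RigidityAll.secAt_false_subset_secAt_true e (hU 0)) (RigidityAll.secAt_false_subset_secAt_true e (hU 1))
  linarith

/-- **`Λ_e(U) ≥ 0` at a coordinate saturating `U₂`.** [this work] -/
theorem mixC2_ge_sahiE_of_third_univ (p : ι → unitInterval) (e : ι) (U : Fin 3 → Set (Set ι)) (hU : ∀ j, IsUpperSet (U j))
    (h2 : secAt e true (U 2) = Set.univ) :
    sahiE (bernoulliWeight p) 3 (fun j => ind (secAt e true (U j)))
      ≤ mixC2 (bernoulliWeight p) (fun j => secAt e false (U j)) (fun j => secAt e true (U j)) := by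
  have h := mixC2_sub_sahiE_ge_cov_of_third_univ p e U hU h2
  have hcov := cov_ind_nonneg p (isUpperSet_secAt e true (hU 0)) (isUpperSet_secAt e true (hU 1))
  have hl2 : ex (bernoulliWeight p) (ind (secAt e false (U 2))) ≤ 1 := by
    have := ex_ind_sub_of_subset (bernoulliWeight p) (Set.subset_univ (secAt e false (U 2)))
    have hn := ex_ind_nonneg' p (Set.univ \ secAt e false (U 2))
    rw [ex_ind_univ_of_sum_eq_one (sum_bernoulliWeight p)] at this
    linarith
  nlinarith [mul_nonneg (sub_nonneg.2 hl2) hcov]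

/-- **`MD_3` AT A SATURATING COORDINATE**: if `{e} ∈ U₂` (`secAt e true (U 2) = univ`) then for every `p`,
`(1 − p_e)²·E_3(μ_p; U⁰) + p_e²·E_3(μ_p; U¹) ≤ E_3(μ_p; U)`. [this work] -/
theorem sahiE_three_ge_sq_minors_of_third_univ (p : ι → unitInterval) (e : ι) (U : Fin 3 → Set (Set ι))
    (hU : ∀ j, IsUpperSet (U j)) (h2 : secAt e true (U 2) = Set.univ) :
    (1 - (p e : ℝ)) ^ 2 * sahiE (bernoulliWeight p) 3 (fun j => ind (secAt e false (U j)))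
      + (p e : ℝ) ^ 2 * sahiE (bernoulliWeight p) 3 (fun j => ind (secAt e true (U j)))
      ≤ sahiE (bernoulliWeight p) 3 (fun j => ind (U j)) :=
  sahiE_three_ge_sq_minors_of_mixC2_ge e U hU p (mixC2_ge_sahiE_of_third_univ p e U hU h2)

omit [Fintype ι] in
/-- The saturation hypothesis in membership form: `{ω | e ∈ ω} ⊆ U₂` gives `secAt e true (U 2) = univ`. [folklore] -/
theorem secAt_true_eq_univ_of_coordEvent_subset (e : ι) {A : Set (Set ι)} (h : {ω : Set ι | e ∈ ω} ⊆ A) :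
    secAt e true A = Set.univ := by
  ext ω
  simp only [Set.mem_univ, iff_true, mem_secAt, forceAt, cond_true]
  exact h (Set.mem_insert e ω)

/-- **`C_3` inherited at a saturating coordinate**: if `{ω | e ∈ ω} ⊆ U₂` and the two minors have `E_3 ≥ 0`, so has `U`. [this work] -/
theorem sahiE_three_nonneg_of_coordEvent_subset_third (p : ι → unitInterval) (e : ι) (U : Fin 3 → Set (Set ι))
    (hU : ∀ j, IsUpperSet (U j)) (h2 : {ω : Set ι | e ∈ ω} ⊆ U 2)
    (h0 : 0 ≤ sahiE (bernoulliWeight p) 3 (fun j => ind (secAt e false (U j))))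
    (h1 : 0 ≤ sahiE (bernoulliWeight p) 3 (fun j => ind (secAt e true (U j)))) :
    0 ≤ sahiE (bernoulliWeight p) 3 (fun j => ind (U j)) := by
  have h := sahiE_three_ge_sq_minors_of_third_univ p e U hU (secAt_true_eq_univ_of_coordEvent_subset e h2)
  have ht0 : 0 ≤ (p e : ℝ) := (p e).2.1
  have ht1 : 0 ≤ 1 - (p e : ℝ) := sub_nonneg.2 (p e).2.2
  nlinarith [mul_nonneg (pow_nonneg ht1 2) h0, mul_nonneg (pow_nonneg ht0 2) h1]

end Pointwise

end Summit.CriticalPhenomena.PercolationContinuityZ3.Theorems
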